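import Literature.NumberTheory.EllipticCurves.Kato2004.IwasawaCohomologyNumberFieldLoc
import Literature.NumberTheory.EllipticCurves.Kato2004.IntegralH1CorestrictionMackey
import Literature.NumberTheory.GaloisRepresentations.ContinuousCorestrictionComp
import Literature.NumberTheory.GaloisRepresentations.ContinuousCorestrictionRelConj
import HarnessLib

/-!
# The SHAPIRO CORESTRICTION `cor : 𝐇¹_{K,Γ}(T_pW_K) → 𝐇¹_Γ(T_pW)` from the Iwasawa cohomology over a number
# field `K` (tower `K_∞ = K·ℚ_∞`) back to Kato's Iwasawa cohomology over `ℚ`, built levelwise on the pinned carriers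

Topic `NumberTheory/EllipticCurves`, sub-directory `Kato2004`; fourth file of the `K`-carrier vocabulary, after
`IwasawaCohomologyNumberField.lean` (the carrier `IwasawaH1DataOver`), `…Restriction.lean` (the Shapiro restriction
`resOver`) and `…Loc.lean` (the localisation `locOver` at a split place).  Seat `bsd-2adic-conv-1` GEN 30 (cell
`pub/bsd-2adic`), WANTED-CARRIER-K of the pen's RC-366 (2) / RC-369 (b): the corestriction is the map behind the clause
`2·L ≤ loc(𝐇¹_Γ(T₂W)) + loc(𝐇¹_Γ(T₂A))` of the Shapiro lattice `L = loc_w̄ 𝐇¹_{K,Γ}` (`2x = (x + σx) + (x − σx)`,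
`x + σx = res (cor x)`).  HONEST FRAMING: definitions with bodies and proved theorems only; no named fact, no `sorry`;
nothing about any curve is asserted; BSD is not advanced by this file.

Setting (as in `…Restriction.lean`): `κ : ZpExtension ℚ p`, `h : κ ∘ res_{K/ℚ}` onto, the restricted tower `κ.restrict K h`.
The subgroup MODEL of `Γ_{K_n}` inside `Γ_ℚ` is `V_n = galRange K ⊓ Γ_{ℚ_n}` (`layerGalRange`; `galRange K` = the image of
`res : Γ_K → Γ_ℚ`, file `SelmerPInftyRestriction`), an open subgroup of finite index of `U_n = Γ_{ℚ_n}`, identified with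
`Γ_{K_n} ≤ Γ_K` by `rangeToResGal : galRange K ≅ Γ_K`.  The corestriction at level `n` is the composite

  `cor_n : H¹(K_n, T_pW_K) —(transport along (rangeToResGal, θ_∞⁻¹))→ H¹(V_n, T_pW) —cor_{U_n/V_n}→ H¹(ℚ_n, T_pW)`.

* §1 `layerGalRange`, `layerCorHom n : V_n →ₜ* Gal(K̄/K_n)` (through `rangeToResGal`), `layerCorRepHom` (coefficients `θ_∞⁻¹`),
  `layerToGalRange n : H¹(K_n, T_pW_K) → H¹(V_n, T_pW)` (the subgroup model of the `K_n`-cohomology), and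
  **`layerCorOver n : H¹(K_n, T_pW_K) →ₗ H¹(ℚ_n, T_pW)`** `= cor_{U_n/V_n} ∘ layerToGalRange n`.
* §2 `layerToGalRange_mem_integralH1` (integral ↦ integral under the model: `I_𝔔 = res⁻¹ I_{𝔔 ∩ ℤ̄}`, tree
  `comap_inertia_comap_absIntegersMap`), **`layerCorOver_mem_integralH1`** (integral ↦ integral: the GENERAL Mackey lemma
  `coresLe_mem_integralH1_of_le` of `IntegralH1CorestrictionMackey.lean` — `V_n` need not contain the inertia at the primes
  ramified in `K`), `layerCorOver_layerCoresOver` (compatible with the trace maps: transport `map_coresLe_eq_coresLe_map` +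
  transitivity `coresLe_comp`), `layerCorOver_conjMap` (equivariance `cor_n (g·y) = res g · cor_n y`, for `K/ℚ` GALOIS, i.e.
  `galRange K` normal in `Γ_ℚ` — tree `normal_galRange` (degree 2) / `normal_galRange_of_normal`; `coresLe_conjMap`).
* §3 **`IwasawaH1DataOver.corOver IK I hγK hγ : IK.H →ₗ[Λ] I.H`** for `IK : IwasawaH1DataOver (W.baseChange K) p (κ.restrict K h) γK`,
  `I : IwasawaH1Data W p κ γ`: the unique map with `I.proj n (corOver x) = layerCorOver n (IK.proj n x)` (`proj_corOver`,
  `corOver_unique`); `Λ`-linear because `κ(res γK) = κ γ = 1` (`cor_n` intertwines the level operators).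

NOT here (next files): `res ∘ cor = 1 + σ` (normal-case double-coset formula `resLe_coresLe_eq_sum_conjMap`), `cor ∘ res = [K:ℚ]`
(`cores_resSubgroup`), the twisted companions for the quadratic twist `A = W^K`.

References: J. Neukirch, A. Schmidt, K. Wingberg, *Cohomology of Number Fields* (2008), I §5 Prop. 1.5.4, (1.5.6)–(1.5.7)
(cor on cochains, compatible pairs, double cosets) [NeukirchSchmidtWingberg2008]; K. Kato, Astérisque 295 (2004) §8.2, §12.2
[Kato2004Asterisque]; K. Rubin, *Euler Systems* (2000), App. B §3 [Rubin2000]; J.-P. Serre, *Galois Cohomology* (1997) I §2.4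
[SerreGaloisCohomology1997]; L. Washington, GTM 83 §13.1 (`K_∞ = Kℚ_∞`) [Washington1997].
-/

noncomputable section

open scoped NumberField Pointwise
open CategoryTheory Field IsDedekindDomain Polynomial
open Literature.NumberTheory.GaloisRepresentations
open Literature.NumberTheory.EllipticCurves (subgroupInclusion subgroupInclusion_apply_coe
  subgroupConj subgroupConj_apply_coe tateModuleEquiv continuous_tateModuleEquiv continuous_tateModuleEquiv_symm
  tateModuleEquiv_tateGaloisRep_restrict galRange rangeToResGal resGal_rangeToResGal resGal isOpen_galRange
  galSubgroupClosure_le_galRange)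
open Literature.NumberTheory.EllipticCurves.Kato2004.CM (tateRepK integralH1K mem_integralH1K_iff)
open Literature.NumberTheory.EllipticCurves.Kato2004.EulerSystemValues (tateRep)

namespace Literature.NumberTheory.EllipticCurves.Kato2004

/-! ## §1 The subgroup model `V_n = galRange K ⊓ Γ_{ℚ_n}` of `Γ_{K_n}` and the corestriction at the `n`-th layer -/

section LayerCor

variable (K : Type) [Field K] [NumberField K] {p : ℕ} [Fact p.Prime] (κ : ZpExtension ℚ p)
  (h : Function.Surjective (κ.toContinuousMonoidHom.comp (absGaloisRestrict ℚ K)))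

/-- **The subgroup model `V_n = galRange K ⊓ Γ_{ℚ_n}` of `Γ_{K_n}` inside `Γ_ℚ`**: the image of `Gal(K̄/K_n) → Γ_ℚ`
(`K_n = K·ℚ_n`). [cite: Washington1997, §13.1] [cite: SerreGaloisCohomology1997, II §1.1] -/
def layerGalRange (n : ℕ) : Subgroup (absoluteGaloisGroup ℚ) := galRange (K := ℚ) K ⊓ κ.layerSubgroup n

/-- Membership in `V_n`. [cite: Washington1997, §13.1] -/
theorem mem_layerGalRange_iff (n : ℕ) (g : absoluteGaloisGroup ℚ) :
    g ∈ layerGalRange K κ n ↔ g ∈ galRange (K := ℚ) K ∧ g ∈ κ.layerSubgroup n := Iff.rfl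

/-- `V_n ≤ Γ_{ℚ_n}`. [cite: Washington1997, §13.1] -/
theorem layerGalRange_le (n : ℕ) : layerGalRange K κ n ≤ κ.layerSubgroup n := inf_le_right

/-- `V_n` is open in `Γ_ℚ` (`galRange K` is open for a number field `K`, `isOpen_galRange`). [cite: SerreGaloisCohomology1997, II §1.1] -/
theorem isOpen_layerGalRange (n : ℕ) : IsOpen (layerGalRange K κ n : Set (absoluteGaloisGroup ℚ)) :=
  (isOpen_galRange (K := ℚ) K).inter (κ.isOpen_layerSubgroup n)

/-- `V_n` has finite index in `Γ_ℚ` (`galRange K ⊇ Γ_{K̃}` of index `[K̃ : ℚ]`; `Γ_{ℚ_n}` open in the compact `Γ_ℚ`).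
[cite: SerreGaloisCohomology1997, II §1.1] -/
theorem finiteIndex_layerGalRange (n : ℕ) : (layerGalRange K κ n).FiniteIndex := by
  haveI : (galRange (K := ℚ) K).FiniteIndex := Subgroup.finiteIndex_of_le (galSubgroupClosure_le_galRange (K := ℚ) K)
  haveI : (κ.layerSubgroup n).FiniteIndex := finiteIndex_of_isOpen_of_compactSpace _ (κ.isOpen_layerSubgroup n)
  exact inferInstanceAs ((galRange (K := ℚ) K ⊓ κ.layerSubgroup n).FiniteIndex)

/-- `Γ_{ℚ_n} ⧸ V_n` is finite. [cite: SerreGaloisCohomology1997, II §1.1] -/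
theorem finite_quotient_layerGalRange (n : ℕ) :
    Finite (κ.layerSubgroup n ⧸ (layerGalRange K κ n).subgroupOf (κ.layerSubgroup n)) := by
  haveI := finiteIndex_layerGalRange K κ n
  infer_instance

/-- For `K/ℚ` Galois (`galRange K ⊴ Γ_ℚ`), `V_n` is normal in `Γ_ℚ`. [cite: SerreGaloisCohomology1997, II §1.1] -/
theorem normal_layerGalRange [(galRange (K := ℚ) K).Normal] (n : ℕ) : (layerGalRange K κ n).Normal :=
  inferInstanceAs ((galRange (K := ℚ) K ⊓ κ.layerSubgroup n).Normal)

/-- `res (rangeToResGal g) = g` for `g ∈ galRange K` (the tree's `resGal_rangeToResGal` in the spelling `absGaloisRestrict`).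
[cite: SerreGaloisCohomology1997, II §1.1] -/
@[simp] theorem absGaloisRestrict_rangeToResGal (g : galRange (K := ℚ) K) :
    absGaloisRestrict ℚ K (rangeToResGal (K := ℚ) K g) = g :=
  resGal_rangeToResGal K g

variable {K} in
/-- Membership transport: for `g ∈ galRange K`, `rangeToResGal g ∈ Gal(K̄/K_n) ↔ g ∈ Γ_{ℚ_n}`. [cite: Washington1997, §13.1] -/
theorem rangeToResGal_mem_layerSubgroup_iff (n : ℕ) (g : galRange (K := ℚ) K) :
    rangeToResGal (K := ℚ) K g ∈ (κ.restrict K h).layerSubgroup n ↔ (g : absoluteGaloisGroup ℚ) ∈ κ.layerSubgroup n := by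
  rw [mem_layerSubgroup_restrict_iff, absGaloisRestrict_rangeToResGal]

/-- **`V_n →ₜ* Gal(K̄/K_n)`**, the identification of the model with the layer of `K` (through `rangeToResGal : galRange K ≅ Γ_K`).
[cite: NeukirchSchmidtWingberg2008, I §5 Prop. 1.5.4 (compatible pairs)] -/
def layerCorHom (n : ℕ) : layerGalRange K κ n →ₜ* (κ.restrict K h).layerSubgroup n where
  toFun g := ⟨rangeToResGal (K := ℚ) K ⟨g, g.2.1⟩, (rangeToResGal_mem_layerSubgroup_iff κ h n ⟨g, g.2.1⟩).mpr g.2.2⟩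
  map_one' := Subtype.ext (by
    change rangeToResGal (K := ℚ) K ⟨((1 : layerGalRange K κ n) : absoluteGaloisGroup ℚ), _⟩ = 1
    exact (congrArg _ (Subtype.ext rfl)).trans (map_one (rangeToResGal (K := ℚ) K)))
  map_mul' a b := Subtype.ext (by
    change rangeToResGal (K := ℚ) K ⟨((a * b : layerGalRange K κ n) : absoluteGaloisGroup ℚ), _⟩ =
      rangeToResGal (K := ℚ) K ⟨a, a.2.1⟩ * rangeToResGal (K := ℚ) K ⟨b, b.2.1⟩
    rw [← map_mul]
    exact congrArg _ (Subtype.ext rfl))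
  continuous_toFun :=
    ((map_continuous (rangeToResGal (K := ℚ) K)).comp (continuous_subtype_val.subtype_mk _)).subtype_mk _

/-- Unfolding `layerCorHom`: `res (layerCorHom n g) = g` in `Γ_ℚ`. [cite: NeukirchSchmidtWingberg2008, I §5 Prop. 1.5.4 (compatible pairs)] -/
@[simp] theorem absGaloisRestrict_layerCorHom (n : ℕ) (g : layerGalRange K κ n) :
    absGaloisRestrict ℚ K ((layerCorHom K κ h n g : (κ.restrict K h).layerSubgroup n) : absoluteGaloisGroup K) = g :=
  absGaloisRestrict_rangeToResGal K ⟨g, g.2.1⟩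

/-- `layerCorHom n g = rangeToResGal g` in `Γ_K`. [cite: NeukirchSchmidtWingberg2008, I §5 Prop. 1.5.4 (compatible pairs)] -/
theorem layerCorHom_apply_coe (n : ℕ) (g : layerGalRange K κ n) :
    ((layerCorHom K κ h n g : (κ.restrict K h).layerSubgroup n) : absoluteGaloisGroup K) =
      rangeToResGal (K := ℚ) K ⟨g, g.2.1⟩ := rfl

/-- `layerCorHom n` is surjective: `σ ∈ Gal(K̄/K_n)` is the image of `res σ ∈ V_n`. [cite: Washington1997, §13.1] -/
theorem layerCorHom_surjective (n : ℕ) : Function.Surjective (layerCorHom K κ h n) := fun σ ↦ by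
  refine ⟨⟨absGaloisRestrict ℚ K σ, ⟨σ, rfl⟩, (mem_layerSubgroup_restrict_iff κ h n _).mp σ.2⟩, Subtype.ext ?_⟩
  apply Literature.NumberTheory.GaloisRepresentations.absGaloisRestrict_injective ℚ K
  rw [absGaloisRestrict_layerCorHom]

variable (W : WeierstrassCurve ℚ) [W.IsElliptic] [ContinuousSMul ℤ_[p] (W.tateModule p)]
  [ContinuousSMul ℤ_[p] ((W.baseChange K).tateModule p)]

variable {K} in
/-- The equivariance of `θ_∞⁻¹` along `rangeToResGal`: `θ_∞⁻¹ (T_p(W_K)(rangeToResGal g) b) = T_pW(g) (θ_∞⁻¹ b)`.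
[cite: SilvermanAEC2009, III.§7 and VII.§4 (T_ℓ(E) as a Galois module under restriction)] -/
theorem tateModuleEquiv_symm_ρ_rangeToResGal (g : galRange (K := ℚ) K) (b : (W.baseChange K).tateModule p) :
    (tateModuleEquiv W K p).symm ((tateRepK (W.baseChange K) p).toTopRep.ρ (rangeToResGal (K := ℚ) K g) b) =
      (tateRep W p).toTopRep.ρ (g : absoluteGaloisGroup ℚ) ((tateModuleEquiv W K p).symm b) := by
  apply (tateModuleEquiv W K p).injective
  rw [LinearEquiv.apply_symm_apply]
  conv_rhs => rw [← absGaloisRestrict_rangeToResGal K g]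
  rw [tateModuleEquiv_toTopRep_ρ, LinearEquiv.apply_symm_apply]

/-- The module half of the compatible pair: `T_p(W_K)|_{Γ_{K_n}}` pulled back along `layerCorHom n` maps to `T_pW|_{V_n}` by `θ_∞⁻¹`.
[cite: NeukirchSchmidtWingberg2008, I §5 Prop. 1.5.4] -/
def layerCorRepHom (n : ℕ) :
    TopRep.res (layerCorHom K κ h n : layerGalRange K κ n →* (κ.restrict K h).layerSubgroup n)
        (subgroupRep (tateRepK (W.baseChange K) p).toTopRep ((κ.restrict K h).layerSubgroup n)) ⟶
      subgroupRep (tateRep W p).toTopRep (layerGalRange K κ n) :=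
  TopRep.ofHom ⟨⟨(tateModuleEquiv W K p).symm.toLinearMap, continuous_tateModuleEquiv_symm W K p⟩, fun g =>
    ContinuousLinearMap.ext fun b => tateModuleEquiv_symm_ρ_rangeToResGal W ⟨g, g.2.1⟩ b⟩

/-- The coefficient map of `cor_n`'s transport is `θ_∞⁻¹`. [cite: NeukirchSchmidtWingberg2008, I §5 Prop. 1.5.4 (compatible pairs)] -/
@[simp] theorem layerCorRepHom_hom_apply (n : ℕ) (b : (W.baseChange K).tateModule p) :
    (layerCorRepHom K κ h W n).hom b = (tateModuleEquiv W K p).symm b := rfl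

/-- **The subgroup model of the `K_n`-cohomology**: `H¹(K_n, T_pW_K) → H¹(V_n, T_pW)`, pull-back along the compatible pair
`(layerCorHom n, θ_∞⁻¹)` (an isomorphism, the pair being invertible; only the map is needed). [cite: SerreGaloisCohomology1997, I §2.4] -/
def layerToGalRange (n : ℕ) :
    H1 (tateRepK (W.baseChange K) p) ((κ.restrict K h).layerSubgroup n) ⟶ H1 (tateRep W p) (layerGalRange K κ n) :=
  ContinuousCohomology.map (layerCorHom K κ h n) (layerCorRepHom K κ h W n) 1

/-- `layerToGalRange` on explicit cocycles: `[φ] ↦ [θ_∞⁻¹ ∘ φ ∘ layerCorHom n]`. [cite: SerreGaloisCohomology1997, I §2.4] -/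
theorem layerToGalRange_oneCocycleClass (n : ℕ)
    (φ : contOneCocycles (subgroupRep (tateRepK (W.baseChange K) p).toTopRep ((κ.restrict K h).layerSubgroup n))) :
    layerToGalRange K κ h W n (oneCocycleClass _ φ) =
      oneCocycleClass _ (contOneCocycles.pullback (layerCorHom K κ h n) (layerCorRepHom K κ h W n) φ) :=
  map_oneCocycleClass _ _ _ φ

/-- **Corestriction at the `n`-th layer**: `cor_n : H¹(K_n, T_pW_K) →ₗ H¹(ℚ_n, T_pW)`, the transport to the model `V_n` followed by
`cor_{U_n/V_n}` (for the canonical finiteness structure on `U_n ⧸ V_n`). [cite: NeukirchSchmidtWingberg2008, I §5 (1.5.6)–(1.5.7)] -/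
def layerCorOver (n : ℕ) :
    H1 (tateRepK (W.baseChange K) p) ((κ.restrict K h).layerSubgroup n) →ₗ[ℤ_[p]] H1 (tateRep W p) (κ.layerSubgroup n) :=
  haveI := finite_quotient_layerGalRange K κ n
  haveI : Fintype (κ.layerSubgroup n ⧸ (layerGalRange K κ n).subgroupOf (κ.layerSubgroup n)) := Fintype.ofFinite _
  (coresLe (tateRep W p).toTopRep (layerGalRange_le K κ n) (isOpen_layerGalRange K κ n)).comp
    (layerToGalRange K κ h W n).hom.toLinearMap

/-- `cor_n = cor_{U_n/V_n} ∘ layerToGalRange n` for ANY finiteness structure on `U_n ⧸ V_n`. [cite: NeukirchSchmidtWingberg2008, I §5 (1.5.6)] -/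
theorem layerCorOver_apply (n : ℕ) [inst : Fintype (κ.layerSubgroup n ⧸ (layerGalRange K κ n).subgroupOf (κ.layerSubgroup n))]
    (y : H1 (tateRepK (W.baseChange K) p) ((κ.restrict K h).layerSubgroup n)) :
    layerCorOver K κ h W n y =
      coresLe (tateRep W p).toTopRep (layerGalRange_le K κ n) (isOpen_layerGalRange K κ n) (layerToGalRange K κ h W n y) := by
  haveI := finite_quotient_layerGalRange K κ n
  obtain rfl : inst = Fintype.ofFinite _ := Subsingleton.elim _ _
  rfl

/-! ## §2 Integrality, compatibility with the trace maps, equivariance -/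

variable {K} in
/-- `(p : 𝓞 K) ∉ w` for a place `w` of `K` above a rational prime `v ≠ p`. [cite: NeukirchANT1999, Ch. I §8] -/
theorem natCast_not_mem_of_under_eq {v : HeightOneSpectrum (𝓞 ℚ)} (hv : ((Rat.HeightOneSpectrum.primesEquiv v : Nat.Primes) : ℕ) ≠ p)
    {w : HeightOneSpectrum (𝓞 K)} (hw : w.asIdeal.under (𝓞 ℚ) = v.asIdeal) : ((p : ℕ) : 𝓞 K) ∉ w.asIdeal := by
  intro hp
  apply hv
  have hmem : ((p : ℕ) : 𝓞 ℚ) ∈ v.asIdeal := by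
    rw [← hw, Ideal.under, Ideal.mem_comap, map_natCast]
    exact hp
  rw [Literature.NumberTheory.EllipticCurves.natCast_mem_asIdeal_iff_eq_primesEquiv_symm _ (Fact.out : p.Prime)] at hmem
  rw [hmem, Equiv.apply_symm_apply]

/-- **The model preserves integrality**: `H¹(O_{K_n}[1/p], T_pW_K) → integralH1 T_pW p V_n` — for a prime `𝔓` of `\bar ℤ` over `v ≠ p` let
`𝔔` be the prime of `\bar ℤ_K` with `𝔔 ∩ \bar ℤ = 𝔓` (`absIntegersMap` is bijective); it lies over a place `w ∤ p` of `K`, and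
`V_n ∩ I_𝔓 = res(Γ_{K_n} ∩ I_𝔔)` (`comap_inertia_comap_absIntegersMap`); a coboundary pulls back to a coboundary.
[cite: Kato2004Asterisque, §8.2 and Lemma 8.5 (pp. 180–184)] -/
theorem layerToGalRange_mem_integralH1 (n : ℕ) {y : H1 (tateRepK (W.baseChange K) p) ((κ.restrict K h).layerSubgroup n)}
    (hy : y ∈ integralH1K (tateRepK (W.baseChange K) p) p ((κ.restrict K h).layerSubgroup n)) :
    layerToGalRange K κ h W n y ∈ integralH1 (tateRep W p) p (layerGalRange K κ n) := by
  rw [mem_integralH1_iff]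
  intro v hv 𝔓 h𝔓
  obtain ⟨φ, rfl⟩ := oneCocycleClass_surjective _ y
  haveI := h𝔓.1
  -- the prime `𝔔` of `\bar ℤ_K` over `𝔓`
  let e := absIntegersEquiv ℚ K
  let 𝔔 : Ideal (absIntegers (𝓞 K) K) := 𝔓.comap e.symm.toRingHom
  have hcomp : e.symm.toRingHom.comp (absIntegersMap ℚ K) = RingHom.id _ := by
    refine RingHom.ext fun x ↦ ?_
    rw [← coe_absIntegersEquiv]
    exact e.symm_apply_apply x
  have h𝔔𝔓 : 𝔔.comap (absIntegersMap ℚ K) = 𝔓 := by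
    rw [Ideal.comap_comap, hcomp, Ideal.comap_id]
  haveI : 𝔔.IsPrime := Ideal.comap_isPrime _ _
  have h𝔔v : 𝔔.comap (absIntegersMap ℚ K) ∈ v.primesAbove := h𝔔𝔓 ▸ h𝔓
  obtain ⟨w, hwv, h𝔔w, -⟩ := exists_heightOneSpectrum_of_comap_absIntegersMap_mem_primesAbove h𝔔v
  have hwp : ((p : ℕ) : 𝓞 K) ∉ w.asIdeal := natCast_not_mem_of_under_eq (p := p) hv hwv
  have h0 := (mem_integralH1K_iff _ _ _ _).mp hy w hwp 𝔔 h𝔔w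
  rw [resLe_oneCocycleClass, oneCocycleClass_eq_zero_iff] at h0
  obtain ⟨b, hb⟩ := h0
  rw [layerToGalRange_oneCocycleClass, resLe_oneCocycleClass, oneCocycleClass_eq_zero_iff]
  refine ⟨(tateModuleEquiv W K p).symm b, fun g ↦ ?_⟩
  -- `rangeToResGal g ∈ Γ_{K_n} ∩ I_𝔔`
  have hgV : (g : absoluteGaloisGroup ℚ) ∈ layerGalRange K κ n := g.2.1
  have hgI : (g : absoluteGaloisGroup ℚ) ∈ 𝔓.inertia (absoluteGaloisGroup ℚ) := g.2.2
  set σ : absoluteGaloisGroup K := rangeToResGal (K := ℚ) K ⟨g, hgV.1⟩ with hσ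
  have hσU : σ ∈ (κ.restrict K h).layerSubgroup n := (rangeToResGal_mem_layerSubgroup_iff κ h n ⟨g, hgV.1⟩).mpr hgV.2
  have hσI : σ ∈ 𝔔.inertia (absoluteGaloisGroup K) := by
    rw [← comap_inertia_comap_absIntegersMap ℚ K 𝔔, Subgroup.mem_comap, h𝔔𝔓]
    change absGaloisRestrict ℚ K σ ∈ _
    rwa [hσ, absGaloisRestrict_rangeToResGal]
  have key : φ.1 (subgroupInclusion inf_le_left ⟨σ, hσU, hσI⟩) = (tateRepK (W.baseChange K) p).toTopRep.ρ σ b - b :=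
    hb ⟨σ, hσU, hσI⟩
  have harg : layerCorHom K κ h n (subgroupInclusion (inf_le_left : layerGalRange K κ n ⊓
        𝔓.inertia (absoluteGaloisGroup ℚ) ≤ layerGalRange K κ n) g) = subgroupInclusion inf_le_left ⟨σ, hσU, hσI⟩ :=
    Subtype.ext rfl
  rw [contOneCocycles.pullback_apply, TopRep.hom_ofHom]
  change (contOneCocycles.pullback (layerCorHom K κ h n) (layerCorRepHom K κ h W n) φ).1
      (subgroupInclusion (inf_le_left : layerGalRange K κ n ⊓ 𝔓.inertia (absoluteGaloisGroup ℚ) ≤ layerGalRange K κ n) g) = _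
  rw [contOneCocycles.pullback_apply, harg, key, layerCorRepHom_hom_apply, map_sub, subgroupRep_ρ_apply, hσ,
    tateModuleEquiv_symm_ρ_rangeToResGal]

/-- **`cor_n` maps integral classes to integral classes**: `H¹(O_{K_n}[1/p], T_pW_K) → H¹(ℤ_n[1/p], T_pW)`.  The model is integral
(`layerToGalRange_mem_integralH1`) and `cor_{U_n/V_n}` preserves integrality by the GENERAL Mackey lemma
`coresLe_mem_integralH1_of_le` (`V_n` does not contain the inertia groups at the primes ramified in `K`: the normal unramified case
`coresLe_mem_integralH1` does not apply). [cite: Kato2004Asterisque, §8.2 and Lemma 8.5 (pp. 180–184)] [cite: NeukirchSchmidtWingberg2008, I §5 (1.5.7)] -/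
theorem layerCorOver_mem_integralH1 (n : ℕ) {y : H1 (tateRepK (W.baseChange K) p) ((κ.restrict K h).layerSubgroup n)}
    (hy : y ∈ integralH1K (tateRepK (W.baseChange K) p) p ((κ.restrict K h).layerSubgroup n)) :
    layerCorOver K κ h W n y ∈ integralH1 (tateRep W p) p (κ.layerSubgroup n) := by
  haveI := finite_quotient_layerGalRange K κ n
  letI : Fintype (κ.layerSubgroup n ⧸ (layerGalRange K κ n).subgroupOf (κ.layerSubgroup n)) := Fintype.ofFinite _
  rw [layerCorOver_apply]
  exact coresLe_mem_integralH1_of_le _ p _ _ (layerToGalRange_mem_integralH1 K κ h W n hy)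

/-- `layerCorHom (n+1)` and `layerCorHom n` agree on `V_{n+1}` (one-sided unfolding). [folklore] -/
private theorem layerCorHom_succ_coe (n : ℕ) (x : layerGalRange K κ (n + 1)) :
    ((layerCorHom K κ h (n + 1) x : (κ.restrict K h).layerSubgroup (n + 1)) : absoluteGaloisGroup K) =
      ((layerCorHom K κ h n ⟨x, x.2.1, κ.layerSubgroup_antitone (Nat.le_succ n) x.2.2⟩ : (κ.restrict K h).layerSubgroup n) :
        absoluteGaloisGroup K) := by
  rw [layerCorHom_apply_coe, layerCorHom_apply_coe]

/-- `V_{n+1} ≤ V_n`. [cite: Washington1997, §13.1] -/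
theorem layerGalRange_antitone (n : ℕ) : layerGalRange K κ (n + 1) ≤ layerGalRange K κ n :=
  fun _ hx ↦ ⟨hx.1, κ.layerSubgroup_antitone (Nat.le_succ n) hx.2⟩

/-- **The model commutes with the trace maps**: `layerToGalRange n ∘ Cor_{K_{n+1}/K_n} = cor_{V_n/V_{n+1}} ∘ layerToGalRange (n+1)`
(transport of `cor` along the invertible pair, `map_coresLe_eq_coresLe_map`). [cite: NeukirchSchmidtWingberg2008, I §5 Prop. 1.5.4 and (1.5.6)] -/
theorem layerToGalRange_layerCoresOver (n : ℕ)
    [Fintype (layerGalRange K κ n ⧸ (layerGalRange K κ (n + 1)).subgroupOf (layerGalRange K κ n))]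
    (y : H1 (tateRepK (W.baseChange K) p) ((κ.restrict K h).layerSubgroup (n + 1))) :
    layerToGalRange K κ h W n (layerCoresOver (tateRepK (W.baseChange K) p) (κ.restrict K h) n y) =
      coresLe (tateRep W p).toTopRep (layerGalRange_antitone K κ n) (isOpen_layerGalRange K κ (n + 1))
        (layerToGalRange K κ h W (n + 1) y) := by
  haveI : CompactSpace (absoluteGaloisGroup K) := absoluteGaloisGroup_compactSpace K
  haveI hfiK : ((κ.restrict K h).layerSubgroup (n + 1)).FiniteIndex :=
    finiteIndex_of_isOpen_of_compactSpace _ ((κ.restrict K h).isOpen_layerSubgroup (n + 1))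
  letI i2 : Fintype ((κ.restrict K h).layerSubgroup n ⧸
      ((κ.restrict K h).layerSubgroup (n + 1)).subgroupOf ((κ.restrict K h).layerSubgroup n)) := Fintype.ofFinite _
  have hcos : ∀ g : (κ.restrict K h).layerSubgroup n, ∃ g' : layerGalRange K κ n,
      (layerCorHom K κ h n g')⁻¹ * g ∈ ((κ.restrict K h).layerSubgroup (n + 1)).subgroupOf ((κ.restrict K h).layerSubgroup n) :=
    fun g ↦ by
      obtain ⟨g', hg'⟩ := layerCorHom_surjective K κ h n g
      exact ⟨g', by rw [hg', inv_mul_cancel]; exact Subgroup.one_mem _⟩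
  rw [layerCoresOver_eq_coresLe (tateRepK (W.baseChange K) p) (κ.restrict K h) n]
  exact map_coresLe_eq_coresLe_map (tateRepK (W.baseChange K) p).toTopRep (tateRep W p).toTopRep
    ((κ.restrict K h).layerSubgroup_antitone (Nat.le_succ n)) ((κ.restrict K h).isOpen_layerSubgroup (n + 1))
    (layerGalRange_antitone K κ n) (isOpen_layerGalRange K κ (n + 1))
    (layerCorHom K κ h n) (layerCorHom K κ h (n + 1)) (layerCorHom_succ_coe K κ h n)
    (fun x ↦ by
      rw [layerCorHom_apply_coe, rangeToResGal_mem_layerSubgroup_iff]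
      exact ⟨fun hx ↦ ⟨x.2.1, hx⟩, fun hx ↦ hx.2⟩) hcos
    (layerCorRepHom K κ h W n) (layerCorRepHom K κ h W (n + 1))
    (fun m ↦ by rw [layerCorRepHom_hom_apply, layerCorRepHom_hom_apply]) y

/-- **Corestriction commutes with the trace maps**: `cor_n ∘ Cor_{K_{n+1}/K_n} = Cor_{ℚ_{n+1}/ℚ_n} ∘ cor_{n+1}` on `H¹(K_{n+1}, T_pW_K)` —
both sides are `cor_{U_n/V_{n+1}} ∘ layerToGalRange (n+1)` by transitivity of corestriction (`coresLe_comp`) along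
`V_{n+1} ≤ V_n ≤ U_n` and `V_{n+1} ≤ U_{n+1} ≤ U_n`. [cite: NeukirchSchmidtWingberg2008, I §5 Prop. 1.5.3 (iii), (1.5.6)] -/
theorem layerCorOver_layerCoresOver (n : ℕ) (y : H1 (tateRepK (W.baseChange K) p) ((κ.restrict K h).layerSubgroup (n + 1))) :
    layerCorOver K κ h W n (layerCoresOver (tateRepK (W.baseChange K) p) (κ.restrict K h) n y) =
      layerCores (tateRep W p) κ n (layerCorOver K κ h W (n + 1) y) := by
  haveI := finite_quotient_layerGalRange K κ n
  haveI := finite_quotient_layerGalRange K κ (n + 1)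
  haveI := finiteIndex_layerGalRange K κ (n + 1)
  haveI hfi : (κ.layerSubgroup (n + 1)).FiniteIndex := finiteIndex_of_isOpen_of_compactSpace _ (κ.isOpen_layerSubgroup (n + 1))
  letI i0 : Fintype (κ.layerSubgroup n ⧸ (layerGalRange K κ n).subgroupOf (κ.layerSubgroup n)) := Fintype.ofFinite _
  letI i1 : Fintype (κ.layerSubgroup (n + 1) ⧸ (layerGalRange K κ (n + 1)).subgroupOf (κ.layerSubgroup (n + 1))) :=
    Fintype.ofFinite _
  letI i2 : Fintype (layerGalRange K κ n ⧸ (layerGalRange K κ (n + 1)).subgroupOf (layerGalRange K κ n)) := Fintype.ofFinite _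
  letI i3 : Fintype (κ.layerSubgroup n ⧸ (layerGalRange K κ (n + 1)).subgroupOf (κ.layerSubgroup n)) := Fintype.ofFinite _
  letI i4 : Fintype (κ.layerSubgroup n ⧸ (κ.layerSubgroup (n + 1)).subgroupOf (κ.layerSubgroup n)) := Fintype.ofFinite _
  rw [layerCorOver_apply, layerCorOver_apply, layerToGalRange_layerCoresOver, layerCores_eq_coresLe (tateRep W p) κ n]
  have h1 := LinearMap.congr_fun (coresLe_comp (tateRep W p).toTopRep (layerGalRange_antitone K κ n) (layerGalRange_le K κ n)
    (isOpen_layerGalRange K κ (n + 1)) (isOpen_layerGalRange K κ n)) (layerToGalRange K κ h W (n + 1) y)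
  have h2 := LinearMap.congr_fun (coresLe_comp (tateRep W p).toTopRep (layerGalRange_le K κ (n + 1))
    (κ.layerSubgroup_antitone (Nat.le_succ n)) (isOpen_layerGalRange K κ (n + 1)) (κ.isOpen_layerSubgroup (n + 1)))
    (layerToGalRange K κ h W (n + 1) y)
  rw [LinearMap.comp_apply] at h1 h2
  rw [h1, h2]

/-- **`layerToGalRange` is equivariant**: `layerToGalRange n (g · y) = res g · layerToGalRange n y` for `g ∈ Γ_K` — for `K/ℚ` Galois, so that `res g`
acts on `H¹(V_n, T_pW)` (`V_n ⊴ Γ_ℚ`). [cite: NeukirchSchmidtWingberg2008, I §5 Prop. 1.5.4] -/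
theorem layerToGalRange_conjMap [(galRange (K := ℚ) K).Normal] (n : ℕ) (g : absoluteGaloisGroup K)
    (y : H1 (tateRepK (W.baseChange K) p) ((κ.restrict K h).layerSubgroup n)) :
    layerToGalRange K κ h W n (conjMap (tateRepK (W.baseChange K) p).toTopRep ((κ.restrict K h).layerSubgroup n) g 1 y) =
      (haveI := normal_layerGalRange K κ n;
        conjMap (tateRep W p).toTopRep (layerGalRange K κ n) (absGaloisRestrict ℚ K g) 1 (layerToGalRange K κ h W n y)) := by
  haveI := normal_layerGalRange K κ n
  obtain ⟨φ, rfl⟩ := oneCocycleClass_surjective _ y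
  rw [conjMap_oneCocycleClass, layerToGalRange_oneCocycleClass, layerToGalRange_oneCocycleClass, conjMap_oneCocycleClass]
  refine congrArg _ (Subtype.ext (ContinuousMap.ext fun x => ?_))
  have harg : layerCorHom K κ h n (subgroupConj (layerGalRange K κ n) (absGaloisRestrict ℚ K g) x) =
      subgroupConj ((κ.restrict K h).layerSubgroup n) g (layerCorHom K κ h n x) := by
    apply Subtype.ext
    apply Literature.NumberTheory.GaloisRepresentations.absGaloisRestrict_injective ℚ K
    simp [subgroupConj_apply_coe, map_mul, map_inv]
  rw [contOneCocycles.pullback_apply, conj_pullback_apply, conj_pullback_apply, contOneCocycles.pullback_apply, harg,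
    layerCorRepHom_hom_apply, layerCorRepHom_hom_apply]
  have key := tateModuleEquiv_symm_ρ_rangeToResGal W ⟨absGaloisRestrict ℚ K g, g, rfl⟩
    (φ.1 (subgroupConj ((κ.restrict K h).layerSubgroup n) g (layerCorHom K κ h n x)))
  have hg : rangeToResGal (K := ℚ) K ⟨absGaloisRestrict ℚ K g, g, rfl⟩ = g := by
    apply Literature.NumberTheory.GaloisRepresentations.absGaloisRestrict_injective ℚ K
    rw [absGaloisRestrict_rangeToResGal]
  rw [hg] at key
  exact key

/-- **`cor_n` is equivariant** (for `K/ℚ` Galois): `cor_n (g · y) = res g · cor_n y`, `g ∈ Γ_K` (`layerToGalRange_conjMap` and the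
equivariance of the relative corestriction `coresLe_conjMap` along the normal subgroups `V_n ≤ U_n` of `Γ_ℚ`).
[cite: NeukirchSchmidtWingberg2008, I §5 Prop. 1.5.4] -/
theorem layerCorOver_conjMap [(galRange (K := ℚ) K).Normal] (n : ℕ) (g : absoluteGaloisGroup K)
    (y : H1 (tateRepK (W.baseChange K) p) ((κ.restrict K h).layerSubgroup n)) :
    layerCorOver K κ h W n (conjMap (tateRepK (W.baseChange K) p).toTopRep ((κ.restrict K h).layerSubgroup n) g 1 y) =
      conjMap (tateRep W p).toTopRep (κ.layerSubgroup n) (absGaloisRestrict ℚ K g) 1 (layerCorOver K κ h W n y) := by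
  haveI := normal_layerGalRange K κ n
  haveI := finite_quotient_layerGalRange K κ n
  letI : Fintype (κ.layerSubgroup n ⧸ (layerGalRange K κ n).subgroupOf (κ.layerSubgroup n)) := Fintype.ofFinite _
  rw [layerCorOver_apply, layerCorOver_apply, layerToGalRange_conjMap]
  exact coresLe_conjMap (tateRep W p).toTopRep (layerGalRange_le K κ n) (isOpen_layerGalRange K κ n) _ _

end LayerCor

/-! ## §3 The corestriction `cor : 𝐇¹_{K,Γ}(T_pW_K) → 𝐇¹_Γ(T_pW)` on the pinned carriers -/

section Cor

variable {K : Type} [Field K] [NumberField K] {p : ℕ} [Fact p.Prime] {κ : ZpExtension ℚ p}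
  {h : Function.Surjective (κ.toContinuousMonoidHom.comp (absGaloisRestrict ℚ K))}
  {W : WeierstrassCurve ℚ} [W.IsElliptic] [ContinuousSMul ℤ_[p] (W.tateModule p)]
  [ContinuousSMul ℤ_[p] ((W.baseChange K).tateModule p)]
  {γ : absoluteGaloisGroup ℚ} {γK : absoluteGaloisGroup K}
  (IK : IwasawaH1DataOver (W.baseChange K) p (κ.restrict K h) γK) (I : IwasawaH1Data W p κ γ)

/-- A linear map intertwining two endomorphisms intertwines the polynomials in them. [folklore] -/
private theorem map_aeval_apply_of_comp_eq_cor {N₁ N₂ : Type*} [AddCommGroup N₁] [Module ℤ_[p] N₁]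
    [AddCommGroup N₂] [Module ℤ_[p] N₂] (g : N₁ →ₗ[ℤ_[p]] N₂) (a : Module.End ℤ_[p] N₁) (b : Module.End ℤ_[p] N₂)
    (hg : g ∘ₗ a = b ∘ₗ g) (r : ℤ_[p][X]) (m : N₁) : g (aeval a r m) = aeval b r (g m) := by
  induction r using Polynomial.induction_on generalizing m with
  | C c => simp
  | add f₁ f₂ h₁ h₂ => simp [h₁, h₂]
  | monomial k c hk =>
    have hc : ∀ m, g (a m) = b (g m) := fun m => by simpa using LinearMap.congr_fun hg m
    rw [pow_succ, ← mul_assoc]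
    conv_rhs => rw [map_mul, Module.End.mul_apply, aeval_X]
    conv_lhs => rw [map_mul, Module.End.mul_apply, aeval_X]
    rw [hk, hc]

namespace IwasawaH1DataOver

/-- The levelwise corestrictions of an element of `𝐇¹_{K,Γ}(T_pW_K)`: the family `(cor_n (proj n x))_n`. [cite: NeukirchSchmidtWingberg2008, I §5] -/
def corFamily (x : IK.H) : ∀ n : ℕ, H1 (tateRep W p) (κ.layerSubgroup n) := fun n ↦ layerCorOver K κ h W n (IK.proj n x)

/-- Unfolding `corFamily`. [cite: NeukirchSchmidtWingberg2008, I §5 (1.5.6)] -/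
@[simp] theorem corFamily_apply (x : IK.H) (n : ℕ) : IK.corFamily (W := W) x n = layerCorOver K κ h W n (IK.proj n x) := rfl

/-- The levelwise corestrictions of `x ∈ 𝐇¹_{K,Γ}(T_pW_K)` form a norm-compatible INTEGRAL family over `ℚ`
(`layerCorOver_mem_integralH1`, `layerCorOver_layerCoresOver`, `cores_proj`). [cite: Kato2004Asterisque, §12.2 (p. 220)] -/
theorem isNormCompatible_corFamily (x : IK.H) : IsNormCompatible (tateRep W p) κ (IK.corFamily (W := W) x) :=
  ⟨fun n ↦ layerCorOver_mem_integralH1 K κ h W n (IK.proj_mem n x),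
    fun n ↦ by rw [corFamily_apply, corFamily_apply, ← layerCorOver_layerCoresOver, IK.cores_proj]⟩

/-- `cor_n` intertwines the LEVEL OPERATORS of the two pins (for `K/ℚ` Galois): `cor_n ∘ (conj_{γK} − 1) = (conj_γ − 1) ∘ cor_n`
(`conj_{res γK} = conj_γ` on `H¹(ℚ_n, T_pW)` since `(res γK)⁻¹ γ ∈ Γ_{ℚ_n}`). [cite: NeukirchSchmidtWingberg2008, I §5 Prop. 1.5.4] -/
theorem layerCorOver_comp_conj_sub_one [(galRange (K := ℚ) K).Normal] (hγ : κ.IsTopGenerator γ)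
    (hγK : (κ.restrict K h).IsTopGenerator γK) (n : ℕ) :
    (layerCorOver K κ h W n) ∘ₗ
        ((conjMap (tateRepK (W.baseChange K) p).toTopRep ((κ.restrict K h).layerSubgroup n) γK 1).hom.toLinearMap - 1) =
      ((conjMap (tateRep W p).toTopRep (κ.layerSubgroup n) γ 1).hom.toLinearMap - 1) ∘ₗ (layerCorOver K κ h W n) := by
  refine LinearMap.ext fun y ↦ ?_
  simp only [LinearMap.coe_comp, Function.comp_apply, LinearMap.sub_apply, Module.End.one_apply, map_sub]
  change layerCorOver K κ h W n (conjMap (tateRepK (W.baseChange K) p).toTopRep ((κ.restrict K h).layerSubgroup n) γK 1 y) - _ =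
    conjMap (tateRep W p).toTopRep (κ.layerSubgroup n) γ 1 (layerCorOver K κ h W n y) - _
  rw [layerCorOver_conjMap, conjMap_apply_one_eq_of_inv_mul_mem (tateRep W p).toTopRep (κ.layerSubgroup n)
      (IwasawaH1Data.inv_mul_mem_layerSubgroup_of_isTopGenerator_restrict hγ hγK n)]

/-- **The Shapiro corestriction `cor : 𝐇¹_{K,Γ}(T_pW_K) → 𝐇¹_Γ(T_pW)`** for the pinned `K`-datum `IK` (tower `K·ℚ_∞`, keying
`κ.restrict K h`) and `ℚ`-datum `I`, topological generators `γK`, `γ`, `K/ℚ` Galois: the unique map with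
`I.proj n (cor x) = cor_n (IK.proj n x)` (`proj_corOver`, `corOver_unique`).  `Λ`-LINEAR: additive by construction; compatible with
polynomials in `X` because `cor_n` intertwines the level operators (`layerCorOver_comp_conj_sub_one`), and with all of `Λ` because both
actions are levelwise through `Λ/(ω_n)` (`IwasawaH1Data.proj_smul`, `IwasawaH1DataOver.proj_smul`).
[cite: NeukirchSchmidtWingberg2008, I §5 (1.5.6)–(1.5.7)] [cite: Rubin2000, App. B §3] -/
def corOver [(galRange (K := ℚ) K).Normal] (hγK : (κ.restrict K h).IsTopGenerator γK) (hγ : κ.IsTopGenerator γ) :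
    IK.H →ₗ[IwasawaAlgebra p] I.H where
  toFun x := (I.proj_surjective _ (IK.isNormCompatible_corFamily (W := W) x)).choose
  map_add' x x' := I.ext_of_proj fun n ↦ by
    rw [map_add, (I.proj_surjective _ (IK.isNormCompatible_corFamily (W := W) (x + x'))).choose_spec,
      (I.proj_surjective _ (IK.isNormCompatible_corFamily (W := W) x)).choose_spec,
      (I.proj_surjective _ (IK.isNormCompatible_corFamily (W := W) x')).choose_spec,
      corFamily_apply, corFamily_apply, corFamily_apply, map_add, map_add]
  map_smul' f x := I.ext_of_proj fun n ↦ by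
    obtain ⟨r, hr⟩ := IwasawaH1Exists.exists_polynomial_sub_coe_mem_span p n f
    rw [RingHom.id_apply,
      (I.proj_surjective _ (IK.isNormCompatible_corFamily (W := W) (f • x))).choose_spec,
      I.proj_smul hγ n hr,
      (I.proj_surjective _ (IK.isNormCompatible_corFamily (W := W) x)).choose_spec,
      corFamily_apply, corFamily_apply, IK.proj_smul hγK n hr]
    exact map_aeval_apply_of_comp_eq_cor (layerCorOver K κ h W n) _ _
      (layerCorOver_comp_conj_sub_one (W := W) hγ hγK n) r (IK.proj n x)

/-- **The defining property of `cor`**: `I.proj n (cor x) = cor_n (IK.proj n x)`. [cite: NeukirchSchmidtWingberg2008, I §5 (1.5.6)] -/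
theorem proj_corOver [(galRange (K := ℚ) K).Normal] (hγK : (κ.restrict K h).IsTopGenerator γK) (hγ : κ.IsTopGenerator γ)
    (n : ℕ) (x : IK.H) :
    I.proj n (IK.corOver I hγK hγ x) = layerCorOver K κ h W n (IK.proj n x) :=
  (I.proj_surjective _ (IK.isNormCompatible_corFamily (W := W) x)).choose_spec n

/-- **Uniqueness of `cor`**: any map `IK.H → I.H` computed levelwise by the `cor_n` IS `corOver` (`I.proj` is jointly injective).
[cite: Rubin2000, App. B §2–§3 (maps into an inverse limit are determined levelwise)] -/
theorem corOver_unique [(galRange (K := ℚ) K).Normal] (hγK : (κ.restrict K h).IsTopGenerator γK) (hγ : κ.IsTopGenerator γ)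
    {f : IK.H → I.H} (hf : ∀ (n : ℕ) (x : IK.H), I.proj n (f x) = layerCorOver K κ h W n (IK.proj n x)) :
    f = IK.corOver I hγK hγ :=
  funext fun x ↦ I.ext_of_proj fun n ↦ by rw [hf, proj_corOver]

/-- `cor` of the `Λ`-adic class of a norm-compatible integral family `(y_n)_n` over `K` is the `Λ`-adic class of the corestricted
family `(cor_n y_n)_n` over `ℚ`. [cite: Rubin2000, App. B §3] -/
theorem proj_corOver_of_proj_eq [(galRange (K := ℚ) K).Normal] (hγK : (κ.restrict K h).IsTopGenerator γK)
    (hγ : κ.IsTopGenerator γ) {x : IK.H}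
    {y : ∀ n : ℕ, H1 (tateRepK (W.baseChange K) p) ((κ.restrict K h).layerSubgroup n)} (hx : ∀ n, IK.proj n x = y n) (n : ℕ) :
    I.proj n (IK.corOver I hγK hγ x) = layerCorOver K κ h W n (y n) := by
  rw [proj_corOver, hx]

end IwasawaH1DataOver

end Cor

end Literature.NumberTheory.EllipticCurves.Kato2004

end
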